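import Mathlib
import HarnessLib
import Literature.MathematicalPhysics.QuantumLattice.HubbardTwoPointSimplexMatch
import Literature.MathematicalPhysics.QuantumLattice.ShiftedHubbardTwoTimeDeterminant

/-!
# Child `KLRegimeVolumeLimitV12` (stmt-HubbardSuperconductivity-19858), `stub_vl_bound` via (H1), step C3a: the entries of the two-time
# split-pair propagator matrix ON THE TORUS as character sums (seat hubbard-kl-k3c5-p1 g4; HOME/hubbard-kl-k3c5-p1/H1-DESIGN.md §5)

The Hamiltonian side of (H1) is the determinant series `hasSum_hubbard_twoPoint_twoTime_renormalised_det` (Literature, p490677) whose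
matrix is `splitPairMatrix β h K n hK (creVec-data) (annVec-data)` with `h = hubbardOneBody (fermionTorusGraph 2 L) 1 μ`.  Here its four
entry types are evaluated on the `L×L` torus (`L ≥ 3`) as momentum sums `[ς′=ς] L⁻² Σ_k χ_k(y′ − y) e^{−(τ′−τ)(ε_k−μ)} f_{±β}(ε_k−μ)` — the
form in which they are matched with `vertexLimitEntry` (C3b; the `(0,0)` case is the anchor
`KLProgrammeKLRegimeVolumeLimitTwoTimeAnchor`).  INSTANCE NOTE: the closed forms produced by the generic (`ι`-level) lemmas carry the
`LinearOrder`-derived `DecidableEq (Orb (FermionTorus 2 L))`, the torus evaluation lemmas the derived one; the two are bridged with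
`convert … using 12` (the instance subgoals are subsingletons).
-/

noncomputable section

namespace Summit.HubbardSuperconductivity.HubbardSuperconductivity.Theorems.TwoPointAssembly

set_option linter.dupNamespace false -- summit = problem name (single-conjunct summit), D-0017

open Finset NormedSpace Matrix Literature.MathematicalPhysics.QuantumLattice Literature.Probability.LatticeModels

variable {L : ℕ} [NeZero L]

/-- The Fermi product of the torus one-body matrix is a momentum multiplier:
`e^{−τ′h}(1+e^{γh})⁻¹e^{τh} = multiplier[k ↦ e^{−(τ′−τ)(ε_k−μ)} f_γ(ε_k−μ)]` (`L ≥ 3`). -/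
theorem fermiProduct_torus_eq (hL : 3 ≤ L) (γ μ : ℝ) (τ τ' : ℂ) :
    exp (-(τ' • hubbardOneBody (fermionTorusGraph 2 L) 1 μ)) *
        (1 + exp ((γ : ℂ) • hubbardOneBody (fermionTorusGraph 2 L) 1 μ))⁻¹ * exp (τ • hubbardOneBody (fermionTorusGraph 2 L) 1 μ) =
      torusMultiplier fun k => Complex.exp (-(τ' - τ) * ((torusBand L k - μ : ℝ) : ℂ)) * (fermiFunction γ (torusBand L k - μ) : ℂ) := by
  rw [fermiMatrix_torus_eq_freeFermiMatrix hL, freeFermiMatrix_eq_torusMultiplier,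
    show -(τ' • hubbardOneBody (fermionTorusGraph 2 L) 1 μ) = (-τ') • hubbardOneBody (fermionTorusGraph 2 L) 1 μ from (neg_smul _ _).symm,
    exp_smul_hubbardOneBody_eq_torusMultiplier hL, exp_smul_hubbardOneBody_eq_torusMultiplier hL, torusMultiplier_mul, torusMultiplier_mul]
  congr 1
  funext k
  rw [mul_right_comm, ← Complex.exp_add]
  congr 2
  ring

/-- The same with the hole Fermi function `(1+e^{−βh})⁻¹ = multiplier[f_{−β}]`. -/
theorem fermiProduct_torus_eq_neg (hL : 3 ≤ L) (β μ : ℝ) (τ τ' : ℂ) :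
    exp (-(τ' • hubbardOneBody (fermionTorusGraph 2 L) 1 μ)) *
        (1 + exp (-((β : ℂ) • hubbardOneBody (fermionTorusGraph 2 L) 1 μ)))⁻¹ * exp (τ • hubbardOneBody (fermionTorusGraph 2 L) 1 μ) =
      torusMultiplier fun k => Complex.exp (-(τ' - τ) * ((torusBand L k - μ : ℝ) : ℂ)) * (fermiFunction (-β) (torusBand L k - μ) : ℂ) := by
  rw [show -((β : ℂ) • hubbardOneBody (fermionTorusGraph 2 L) 1 μ) = (((-β : ℝ)) : ℂ) • hubbardOneBody (fermionTorusGraph 2 L) 1 μ by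
    rw [Complex.ofReal_neg, neg_smul]]
  exact fermiProduct_torus_eq hL (-β) μ τ τ'

section Entries

variable (hL : 3 ≤ L) (β μ : ℝ) (K n : ℕ) (hK : K ≤ n)
  (yc : Fin (n + 1) → FermionTorus 2 L) (ςc : Fin (n + 1) → Fin 2) (τc : Fin (n + 1) → ℂ)
  (ya : Fin (n + 1) → FermionTorus 2 L) (ςa : Fin (n + 1) → Fin 2) (τa : Fin (n + 1) → ℂ)
include hL

/-- The momentum-sum value of a particle (`γ = β`) or hole (`γ = −β`) Fermi product entry on the torus. -/
def torusEntry (γ μ : ℝ) (τ τ' : ℂ) (y y' : FermionTorus 2 L) (ς ς' : Fin 2) : ℂ :=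
  if ς' = ς then ((L : ℂ) ^ 2)⁻¹ * ∑ k : TorusSite 2 L, torusChar k (y'.toTorusSite - y.toTorusSite) *
    (Complex.exp (-(τ' - τ) * ((torusBand L k - μ : ℝ) : ℂ)) * (fermiFunction γ (torusBand L k - μ) : ℂ)) else 0

omit hL in
/-- Unfolding `torusEntry`. -/
theorem torusEntry_def (γ μ : ℝ) (τ τ' : ℂ) (y y' : FermionTorus 2 L) (ς ς' : Fin 2) :
    torusEntry (L := L) γ μ τ τ' y y' ς ς' = if ς' = ς then ((L : ℂ) ^ 2)⁻¹ * ∑ k : TorusSite 2 L,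
      torusChar k (y'.toTorusSite - y.toTorusSite) *
        (Complex.exp (-(τ' - τ) * ((torusBand L k - μ : ℝ) : ℂ)) * (fermiFunction γ (torusBand L k - μ) : ℂ)) else 0 := rfl

/-- **Entry `(0,0)` on the torus**: `−(hole entry)` between the leading annihilation `(ya₀, ςa₀; τa₀)` and the inserted creation
`(yc_K, ςc_K; τc_K)`. -/
theorem splitPairMatrix_torus_zero_zero :
    splitPairMatrix β (hubbardOneBody (fermionTorusGraph 2 L) 1 μ) K n hK
        (fun i => creVec (hubbardOneBody (fermionTorusGraph 2 L) 1 μ) (τc i) (orb (yc i) (ςc i)))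
        (fun b => annVec (hubbardOneBody (fermionTorusGraph 2 L) 1 μ) (τa b) (orb (ya b) (ςa b))) 0 0 =
      -torusEntry (L := L) (-β) μ (τc ⟨K, Nat.lt_succ_of_le hK⟩) (τa 0) (yc ⟨K, Nat.lt_succ_of_le hK⟩) (ya 0)
        (ςc ⟨K, Nat.lt_succ_of_le hK⟩) (ςa 0) := by
  rw [splitPairMatrix_zero_zero, gibbsState_dGamma_annVec_creVec (isHermitian_hubbardOneBody _ 1 μ), torusEntry_def]
  have e' := congrFun (congrFun (fermiProduct_torus_eq_neg hL β μ (τc ⟨K, Nat.lt_succ_of_le hK⟩) (τa 0))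
    (orb (ya 0) (ςa 0))) (orb (yc ⟨K, Nat.lt_succ_of_le hK⟩) (ςc ⟨K, Nat.lt_succ_of_le hK⟩))
  rw [torusMultiplier_orb] at e'
  rw [neg_inj]
  convert e' using 12

/-- **Entries `(0, m+1)` on the torus**: particle entry if `K ≤ m` (the inserted creation precedes the annihilation of pair `m`),
`−(hole entry)` otherwise. -/
theorem splitPairMatrix_torus_zero_succ (m : Fin n) :
    splitPairMatrix β (hubbardOneBody (fermionTorusGraph 2 L) 1 μ) K n hK
        (fun i => creVec (hubbardOneBody (fermionTorusGraph 2 L) 1 μ) (τc i) (orb (yc i) (ςc i)))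
        (fun b => annVec (hubbardOneBody (fermionTorusGraph 2 L) 1 μ) (τa b) (orb (ya b) (ςa b))) 0 m.succ =
      if K ≤ (m : ℕ) then
        torusEntry (L := L) β μ (τc ⟨K, Nat.lt_succ_of_le hK⟩) (τa m.succ) (yc ⟨K, Nat.lt_succ_of_le hK⟩) (ya m.succ)
          (ςc ⟨K, Nat.lt_succ_of_le hK⟩) (ςa m.succ)
      else -torusEntry (L := L) (-β) μ (τc ⟨K, Nat.lt_succ_of_le hK⟩) (τa m.succ) (yc ⟨K, Nat.lt_succ_of_le hK⟩) (ya m.succ)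
          (ςc ⟨K, Nat.lt_succ_of_le hK⟩) (ςa m.succ) := by
  rw [splitPairMatrix_zero_succ]
  by_cases hKm : K ≤ (m : ℕ)
  · rw [if_pos hKm, if_pos hKm, torusEntry_def, gibbsState_dGamma_creVec_annVec (isHermitian_hubbardOneBody _ 1 μ)]
    have e' := congrFun (congrFun (fermiProduct_torus_eq hL β μ (τc ⟨K, Nat.lt_succ_of_le hK⟩) (τa m.succ))
      (orb (ya m.succ) (ςa m.succ))) (orb (yc ⟨K, Nat.lt_succ_of_le hK⟩) (ςc ⟨K, Nat.lt_succ_of_le hK⟩))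
    rw [torusMultiplier_orb] at e'
    convert e' using 12
  · rw [if_neg hKm, if_neg hKm, torusEntry_def, gibbsState_dGamma_annVec_creVec (isHermitian_hubbardOneBody _ 1 μ), neg_inj]
    have e' := congrFun (congrFun (fermiProduct_torus_eq_neg hL β μ (τc ⟨K, Nat.lt_succ_of_le hK⟩) (τa m.succ))
      (orb (ya m.succ) (ςa m.succ))) (orb (yc ⟨K, Nat.lt_succ_of_le hK⟩) (ςc ⟨K, Nat.lt_succ_of_le hK⟩))
    rw [torusMultiplier_orb] at e'
    convert e' using 12

/-- **Entries `(m+1, 0)` on the torus**: `−(hole entry)` between the leading annihilation and the creation of pair `m`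
(word position `K.succAbove m`). -/
theorem splitPairMatrix_torus_succ_zero (m : Fin n) :
    splitPairMatrix β (hubbardOneBody (fermionTorusGraph 2 L) 1 μ) K n hK
        (fun i => creVec (hubbardOneBody (fermionTorusGraph 2 L) 1 μ) (τc i) (orb (yc i) (ςc i)))
        (fun b => annVec (hubbardOneBody (fermionTorusGraph 2 L) 1 μ) (τa b) (orb (ya b) (ςa b))) m.succ 0 =
      -torusEntry (L := L) (-β) μ (τc ((⟨K, Nat.lt_succ_of_le hK⟩ : Fin (n + 1)).succAbove m)) (τa 0)
        (yc ((⟨K, Nat.lt_succ_of_le hK⟩ : Fin (n + 1)).succAbove m)) (ya 0)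
        (ςc ((⟨K, Nat.lt_succ_of_le hK⟩ : Fin (n + 1)).succAbove m)) (ςa 0) := by
  rw [splitPairMatrix_succ_zero, gibbsState_dGamma_annVec_creVec (isHermitian_hubbardOneBody _ 1 μ), torusEntry_def, neg_inj]
  have e' := congrFun (congrFun (fermiProduct_torus_eq_neg hL β μ (τc ((⟨K, Nat.lt_succ_of_le hK⟩ : Fin (n + 1)).succAbove m))
    (τa 0)) (orb (ya 0) (ςa 0))) (orb (yc ((⟨K, Nat.lt_succ_of_le hK⟩ : Fin (n + 1)).succAbove m))
    (ςc ((⟨K, Nat.lt_succ_of_le hK⟩ : Fin (n + 1)).succAbove m)))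
  rw [torusMultiplier_orb] at e'
  convert e' using 12

/-- **Entries `(m+1, m′+1)` on the torus** (the `propMatrix` rule): particle entry if `m ≤ m′`, `−(hole entry)` otherwise. -/
theorem splitPairMatrix_torus_succ_succ (m m' : Fin n) :
    splitPairMatrix β (hubbardOneBody (fermionTorusGraph 2 L) 1 μ) K n hK
        (fun i => creVec (hubbardOneBody (fermionTorusGraph 2 L) 1 μ) (τc i) (orb (yc i) (ςc i)))
        (fun b => annVec (hubbardOneBody (fermionTorusGraph 2 L) 1 μ) (τa b) (orb (ya b) (ςa b))) m.succ m'.succ =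
      if m ≤ m' then
        torusEntry (L := L) β μ (τc ((⟨K, Nat.lt_succ_of_le hK⟩ : Fin (n + 1)).succAbove m)) (τa m'.succ)
          (yc ((⟨K, Nat.lt_succ_of_le hK⟩ : Fin (n + 1)).succAbove m)) (ya m'.succ)
          (ςc ((⟨K, Nat.lt_succ_of_le hK⟩ : Fin (n + 1)).succAbove m)) (ςa m'.succ)
      else -torusEntry (L := L) (-β) μ (τc ((⟨K, Nat.lt_succ_of_le hK⟩ : Fin (n + 1)).succAbove m)) (τa m'.succ)
          (yc ((⟨K, Nat.lt_succ_of_le hK⟩ : Fin (n + 1)).succAbove m)) (ya m'.succ)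
          (ςc ((⟨K, Nat.lt_succ_of_le hK⟩ : Fin (n + 1)).succAbove m)) (ςa m'.succ) := by
  rw [splitPairMatrix_succ_succ]
  by_cases hmm : m ≤ m'
  · rw [if_pos hmm, if_pos hmm, torusEntry_def, gibbsState_dGamma_creVec_annVec (isHermitian_hubbardOneBody _ 1 μ)]
    have e' := congrFun (congrFun (fermiProduct_torus_eq hL β μ (τc ((⟨K, Nat.lt_succ_of_le hK⟩ : Fin (n + 1)).succAbove m))
      (τa m'.succ)) (orb (ya m'.succ) (ςa m'.succ))) (orb (yc ((⟨K, Nat.lt_succ_of_le hK⟩ : Fin (n + 1)).succAbove m))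
      (ςc ((⟨K, Nat.lt_succ_of_le hK⟩ : Fin (n + 1)).succAbove m)))
    rw [torusMultiplier_orb] at e'
    convert e' using 12
  · rw [if_neg hmm, if_neg hmm, torusEntry_def, gibbsState_dGamma_annVec_creVec (isHermitian_hubbardOneBody _ 1 μ), neg_inj]
    have e' := congrFun (congrFun (fermiProduct_torus_eq_neg hL β μ (τc ((⟨K, Nat.lt_succ_of_le hK⟩ : Fin (n + 1)).succAbove m))
      (τa m'.succ)) (orb (ya m'.succ) (ςa m'.succ))) (orb (yc ((⟨K, Nat.lt_succ_of_le hK⟩ : Fin (n + 1)).succAbove m))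
      (ςc ((⟨K, Nat.lt_succ_of_le hK⟩ : Fin (n + 1)).succAbove m)))
    rw [torusMultiplier_orb] at e'
    convert e' using 12

end Entries

end Summit.HubbardSuperconductivity.HubbardSuperconductivity.Theorems.TwoPointAssembly

end
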